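import Literature.MeasureTheory.OptimalTransport.KantorovichDuality
import Mathlib.Topology.ContinuousMap.Bounded.ArzelaAscoli
import Mathlib.MeasureTheory.Integral.BoundedContinuousFunction
import Mathlib.Topology.MetricSpace.Equicontinuity
import HarnessLib

/-!
# Kantorovich–Rubinstein duality for metric costs (compact case)

When the cost `c` on `X × X` is a continuous (pseudo-)metric cost — `c(x,x) = 0`,
symmetric, triangle inequality — the dual problem reduces to a single potential,
`sup { ∫ ζ d(μ - ν) : ζ(x) - ζ(y) ≤ c(x, y) }` (Kantorovich–Rubinstein; Villani 2003,
Thm. 1.14 / §1.2, via the `c`-concavity trick `ψ ↦ φ^c`, Rem. 1.12–1.13), this supremum is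
attained (Arzelà–Ascoli), and with the optimal plan of `exists_isCoupling_isLUB_integral` one
gets the complementary slackness `ζ(x) - ζ(y) = c(x, y)` `π`-a.e.

## Main statements

* `IsMetricCost c`, `IsKRPotential c ζ` (`ζ x - ζ y ≤ c (x, y)`), `krValues μ ν c`;
* `exists_isKRPotential_ge` — the `c`-concavity reduction of pair sub-solutions to potentials;
* `exists_isKRPotential_isMax` — attainment of the KR supremum (Arzelà–Ascoli);
* `exists_isCoupling_isKRPotential` — optimal plan `π` and optimal potential `ζ` with
  `∫ c dπ = ∫ ζ dμ - ∫ ζ dν` and complementary slackness `ζ x - ζ y = c (x, y)` `π`-a.e.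

Tree: `Literature.Analysis.FunctionSpaces.Torus.krLogDist` (file `KantorovichLogDistance`) is the
dual-form KR distance with logarithmic cost on `T^d`; this file supplies the primal side for it.

## References

* C. Villani, *Topics in Optimal Transportation*, GSM 58 (AMS 2003), Thm. 1.3, Rem. 1.12–1.13,
  Thm. 1.14 (Kantorovich–Rubinstein). [`Villani2003`]
-/

noncomputable section

open _root_.MeasureTheory _root_.MeasureTheory.Measure Set Filter
open scoped Topology BoundedContinuousFunction

namespace Literature.MeasureTheory.OptimalTransport

section KantorovichRubinstein

variable {X : Type*} [MetricSpace X] [CompactSpace X] [MeasurableSpace X] [BorelSpace X]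

/-- A continuous **metric cost** on `X`: vanishing on the diagonal, symmetric and satisfying
the triangle inequality (e.g. `c = d`, or `c = φ ∘ d` for a concave modulus `φ`, such as the
logarithmic cost `log (d/δ + 1)` of Seis' mixing estimates). [cite: Villani2003, Thm. 1.14] -/
structure IsMetricCost (c : C(X × X, ℝ)) : Prop where
  /-- `c(x, x) = 0`. -/
  self : ∀ x, c (x, x) = 0
  /-- Symmetry. -/
  symm : ∀ x y, c (x, y) = c (y, x)
  /-- Triangle inequality. -/
  triangle : ∀ x y z, c (x, z) ≤ c (x, y) + c (y, z)

namespace IsMetricCost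

variable {c : C(X × X, ℝ)}

omit [CompactSpace X] [MeasurableSpace X] [BorelSpace X] in
/-- A metric cost is nonnegative. [folklore] -/
theorem nonneg (hc : IsMetricCost c) (x y : X) : 0 ≤ c (x, y) := by
  have h := hc.triangle x y x
  rw [hc.self, hc.symm y x] at h
  linarith

omit [CompactSpace X] [MeasurableSpace X] [BorelSpace X] in
/-- `c(x, ·)` tends to `0` at `x`. [folklore] -/
theorem tendsto_zero (hc : IsMetricCost c) (x : X) :
    Tendsto (fun y => c (x, y)) (𝓝 x) (𝓝 0) := by
  have h : Continuous fun y => c (x, y) := by fun_prop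
  simpa [hc.self x] using h.tendsto x

end IsMetricCost

/-- `ζ` is a **Kantorovich–Rubinstein potential** for the cost `c`: `ζ(x) - ζ(y) ≤ c(x, y)`
(`c`-Lipschitz with constant one). [cite: Villani2003, Thm. 1.14] -/
def IsKRPotential (c : C(X × X, ℝ)) (ζ : X → ℝ) : Prop :=
  ∀ x y, ζ x - ζ y ≤ c (x, y)

namespace IsKRPotential

variable {c : C(X × X, ℝ)} {ζ : X → ℝ}

omit [CompactSpace X] [MeasurableSpace X] [BorelSpace X] in
/-- Two-sided form of the potential inequality for a symmetric cost. [folklore] -/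
theorem abs_sub_le (h : IsKRPotential c ζ) (hc : IsMetricCost c) (x y : X) :
    |ζ x - ζ y| ≤ c (x, y) := by
  rw [abs_sub_le_iff]
  exact ⟨h x y, by rw [hc.symm]; exact h y x⟩

omit [CompactSpace X] [MeasurableSpace X] [BorelSpace X] in
/-- A KR potential for a continuous metric cost is continuous. [folklore] -/
theorem continuous (h : IsKRPotential c ζ) (hc : IsMetricCost c) : Continuous ζ := by
  rw [Metric.continuous_iff]
  intro x ε hε
  have := (hc.tendsto_zero x).eventually (gt_mem_nhds hε)
  obtain ⟨δ, hδ, hball⟩ := Metric.eventually_nhds_iff.mp this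
  refine ⟨δ, hδ, fun y hy => ?_⟩
  rw [Real.dist_eq]
  calc |ζ y - ζ x| = |ζ x - ζ y| := abs_sub_comm _ _
    _ ≤ c (x, y) := h.abs_sub_le hc x y
    _ < ε := hball hy

omit [CompactSpace X] [MeasurableSpace X] [BorelSpace X] in
/-- `0` is a KR potential. [folklore] -/
theorem zero (hc : IsMetricCost c) : IsKRPotential c (0 : X → ℝ) := fun x y => by
  simpa using hc.nonneg x y

omit [CompactSpace X] [MeasurableSpace X] [BorelSpace X] in
/-- KR potentials are stable under adding constants. [folklore] -/
theorem add_const (h : IsKRPotential c ζ) (a : ℝ) : IsKRPotential c (fun x => ζ x + a) :=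
  fun x y => by simpa using h x y

end IsKRPotential

variable (μ ν : Measure X)

/-- The **Kantorovich–Rubinstein dual values** `∫ ζ dμ - ∫ ζ dν` over continuous potentials
`ζ(x) - ζ(y) ≤ c(x, y)`. [cite: Villani2003, Thm. 1.14] -/
def krValues (c : C(X × X, ℝ)) : Set ℝ :=
  {r | ∃ ζ : C(X, ℝ), IsKRPotential c ζ ∧ r = ∫ x, ζ x ∂μ - ∫ x, ζ x ∂ν}

variable {μ ν}

omit [CompactSpace X] [BorelSpace X] in
/-- Every KR value is a dual value (pair `(ζ, -ζ)`). [folklore] -/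
theorem krValues_subset_dualValues (c : C(X × X, ℝ)) : krValues μ ν c ⊆ dualValues μ ν c := by
  rintro r ⟨ζ, hζ, rfl⟩
  refine ⟨ζ, -ζ, fun x y => by simpa [sub_eq_add_neg] using hζ x y, ?_⟩
  simp [integral_neg, sub_eq_add_neg]

/-- **The `c`-concavity trick** (Villani 2003, Rem. 1.12 / proof of Thm. 1.14): for a metric cost,
every pair sub-solution `φ ⊕ ψ ≤ c` is dominated by a single KR potential,
`ζ(y) = sup_x (φ(x) - c(x, y))`, with `φ ≤ ζ ≤ -ψ`, hence
`∫ φ dμ + ∫ ψ dν ≤ ∫ ζ dμ - ∫ ζ dν`. [cite: Villani2003, Thm. 1.14] -/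
theorem exists_isKRPotential_ge [IsFiniteMeasure μ] [IsFiniteMeasure ν] {c : C(X × X, ℝ)}
    (hc : IsMetricCost c) {φ ψ : C(X, ℝ)} (h : ∀ x y, φ x + ψ y ≤ c (x, y)) :
    ∃ ζ : C(X, ℝ), IsKRPotential c ζ ∧
      ∫ x, φ x ∂μ + ∫ x, ψ x ∂ν ≤ ∫ x, ζ x ∂μ - ∫ x, ζ x ∂ν := by
  rcases isEmpty_or_nonempty X with hX | hX
  · refine ⟨0, IsKRPotential.zero hc, ?_⟩
    simp [Measure.eq_zero_of_isEmpty μ, Measure.eq_zero_of_isEmpty ν]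
  -- `ζ y = sup_x (φ x - c (x, y))`
  have hbdd : ∀ y, BddAbove (range fun x => φ x - c (x, y)) := fun y =>
    (isCompact_range (by fun_prop)).bddAbove
  let ζf : X → ℝ := fun y => ⨆ x, (φ x - c (x, y))
  have hζ_ge : ∀ y, φ y ≤ ζf y := fun y => by
    have := le_ciSup (hbdd y) y
    simpa [hc.self y] using this
  have hζ_le : ∀ y, ζf y ≤ -ψ y := fun y =>
    ciSup_le fun x => by linarith [h x y]
  have hpot : IsKRPotential c ζf := by
    intro y y'
    rw [sub_le_iff_le_add]
    refine ciSup_le fun x => ?_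
    have h1 : φ x - c (x, y') ≤ ζf y' := le_ciSup (hbdd y') x
    have h2 := hc.triangle x y y'
    linarith
  let ζ : C(X, ℝ) := ⟨ζf, hpot.continuous hc⟩
  refine ⟨ζ, hpot, ?_⟩
  have hφ := integrable_continuousMap μ φ
  have hψ := integrable_continuousMap ν ψ
  have hζμ := integrable_continuousMap μ ζ
  have hζν := integrable_continuousMap ν ζ
  have i1 : ∫ x, φ x ∂μ ≤ ∫ x, ζ x ∂μ := integral_mono hφ hζμ fun y => hζ_ge y
  have i2 : ∫ x, ψ x ∂ν ≤ -∫ x, ζ x ∂ν := by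
    rw [← integral_neg]
    exact integral_mono hψ hζν.neg fun y => by
      have := hζ_le y
      change ψ y ≤ -ζf y
      linarith
  linarith

/-- **Attainment of the Kantorovich–Rubinstein supremum** (Arzelà–Ascoli): for finite measures
of equal mass and a continuous metric cost there is a continuous optimal potential.
[cite: Villani2003, Thm. 1.14] -/
theorem exists_isKRPotential_isMax [IsFiniteMeasure μ] [IsFiniteMeasure ν] {c : C(X × X, ℝ)}
    (hc : IsMetricCost c) (hmass : μ univ = ν univ) :
    ∃ ζ : C(X, ℝ), IsKRPotential c ζ ∧ ∀ ζ' : C(X, ℝ), IsKRPotential c ζ' →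
      ∫ x, ζ' x ∂μ - ∫ x, ζ' x ∂ν ≤ ∫ x, ζ x ∂μ - ∫ x, ζ x ∂ν := by
  rcases isEmpty_or_nonempty X with hX | hX
  · refine ⟨0, IsKRPotential.zero hc, fun ζ' _ => ?_⟩
    simp [Measure.eq_zero_of_isEmpty μ, Measure.eq_zero_of_isEmpty ν]
  obtain ⟨x₀⟩ := hX
  -- the value functional on bounded continuous functions
  let J : (X →ᵇ ℝ) → ℝ := fun f => ∫ x, f x ∂μ - ∫ x, f x ∂ν
  have hJ : Continuous J := by
    have hL : LipschitzWith ⟨μ.real univ + ν.real univ, by positivity⟩ J := by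
      refine LipschitzWith.of_dist_le_mul fun f g => ?_
      simp only [J, Real.dist_eq]
      have e1 : ∫ x, f x ∂μ - ∫ x, g x ∂μ = ∫ x, (f - g) x ∂μ := by
        rw [← integral_sub (f.integrable μ) (g.integrable μ)]; rfl
      have e2 : ∫ x, f x ∂ν - ∫ x, g x ∂ν = ∫ x, (f - g) x ∂ν := by
        rw [← integral_sub (f.integrable ν) (g.integrable ν)]; rfl
      have b1 := (f - g).norm_integral_le_mul_norm μ
      have b2 := (f - g).norm_integral_le_mul_norm ν
      rw [Real.norm_eq_abs] at b1 b2
      rw [← dist_eq_norm] at b1 b2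
      calc |∫ x, f x ∂μ - ∫ x, f x ∂ν - (∫ x, g x ∂μ - ∫ x, g x ∂ν)|
          = |∫ x, (f - g) x ∂μ - ∫ x, (f - g) x ∂ν| := by rw [← e1, ← e2]; ring_nf
        _ ≤ |∫ x, (f - g) x ∂μ| + |∫ x, (f - g) x ∂ν| := abs_sub _ _
        _ ≤ (μ.real univ + ν.real univ) * dist f g := by rw [add_mul]; exact add_le_add b1 b2
    exact hL.continuous
  -- the compact set of normalised potentials
  let A : Set (X →ᵇ ℝ) := {f | IsKRPotential c f ∧ f x₀ = 0}
  have hA_closed : IsClosed A := by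
    have h1 : IsClosed {f : X →ᵇ ℝ | IsKRPotential c f} := by
      have : {f : X →ᵇ ℝ | IsKRPotential c f} = ⋂ x, ⋂ y, {f : X →ᵇ ℝ | f x - f y ≤ c (x, y)} := by
        ext f; simp [IsKRPotential]
      rw [this]
      refine isClosed_iInter fun x => isClosed_iInter fun y => ?_
      exact isClosed_le ((continuous_eval_const x).sub (continuous_eval_const y)) continuous_const
    have h2 : IsClosed {f : X →ᵇ ℝ | f x₀ = 0} := isClosed_eq (continuous_eval_const x₀) continuous_const
    exact h1.inter h2
  have hA_bound : ∀ (f : X →ᵇ ℝ) (x : X), f ∈ A → f x ∈ Icc (-‖c‖) ‖c‖ := by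
    rintro f x ⟨hf, hf0⟩
    have h1 : f x - f x₀ ≤ c (x, x₀) := hf x x₀
    have h2 : f x₀ - f x ≤ c (x₀, x) := hf x₀ x
    have b1 : c (x, x₀) ≤ ‖c‖ := (le_abs_self _).trans
      (by simpa [Real.norm_eq_abs] using ContinuousMap.norm_coe_le_norm c (x, x₀))
    have b2 : c (x₀, x) ≤ ‖c‖ := (le_abs_self _).trans
      (by simpa [Real.norm_eq_abs] using ContinuousMap.norm_coe_le_norm c (x₀, x))
    rw [hf0] at h1 h2
    constructor <;> linarith
  have hA_equi : Equicontinuous ((↑) : A → X → ℝ) := by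
    intro x
    rw [Metric.equicontinuousAt_iff]
    intro ε hε
    have := (hc.tendsto_zero x).eventually (gt_mem_nhds hε)
    obtain ⟨δ, hδ, hball⟩ := Metric.eventually_nhds_iff.mp this
    refine ⟨δ, hδ, fun y hy => ?_⟩
    rintro ⟨f, hf, -⟩
    rw [Real.dist_eq]
    calc |f x - f y| ≤ c (x, y) := IsKRPotential.abs_sub_le hf hc x y
      _ < ε := hball hy
  have hA_cpt : IsCompact A :=
    BoundedContinuousFunction.arzela_ascoli₂ (Icc (-‖c‖) ‖c‖) isCompact_Icc A hA_closed
      hA_bound hA_equi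
  have hA_ne : A.Nonempty := ⟨0, IsKRPotential.zero hc, rfl⟩
  obtain ⟨f, hfA, hfmax⟩ := hA_cpt.exists_isMaxOn hA_ne hJ.continuousOn
  refine ⟨f.toContinuousMap, hfA.1, fun ζ' hζ' => ?_⟩
  -- normalise `ζ'` and compare
  let g : X →ᵇ ℝ := BoundedContinuousFunction.mkOfCompact (ζ' - ContinuousMap.const X (ζ' x₀))
  have hg : g ∈ A := by
    refine ⟨fun x y => ?_, ?_⟩
    · simp only [g, BoundedContinuousFunction.mkOfCompact_apply, ContinuousMap.sub_apply,
        ContinuousMap.const_apply]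
      linarith [hζ' x y]
    · simp [g]
  have hJg : J g = ∫ x, ζ' x ∂μ - ∫ x, ζ' x ∂ν := by
    simp only [J, g, BoundedContinuousFunction.mkOfCompact_apply, ContinuousMap.sub_apply,
      ContinuousMap.const_apply]
    rw [integral_sub (integrable_continuousMap μ ζ') (integrable_const _),
      integral_sub (integrable_continuousMap ν ζ') (integrable_const _), integral_const,
      integral_const, measureReal_def, measureReal_def, hmass]
    ring
  have := hfmax hg
  simp only [mem_setOf_eq, hJg] at this
  exact this

/-- **Kantorovich–Rubinstein duality with both optimisers and complementary slackness**
(Villani 2003, Thm. 1.3 + Thm. 1.14, compact case): for finite Borel measures `μ`, `ν` of equal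
mass on a compact metric space and a continuous metric cost `c` there are a coupling `π` and a
continuous potential `ζ`, `ζ(x) - ζ(y) ≤ c(x, y)`, with
`∫ c dπ = ∫ ζ dμ - ∫ ζ dν`; consequently `π` minimises the cost among couplings, `ζ` maximises
the KR functional among potentials, and `ζ(x) - ζ(y) = c(x, y)` for `π`-a.e. `(x, y)`.
[cite: Villani2003, Thm. 1.14] -/
theorem exists_isCoupling_isKRPotential [IsFiniteMeasure μ] [IsFiniteMeasure ν]
    {c : C(X × X, ℝ)} (hc : IsMetricCost c) (hmass : μ univ = ν univ) :
    ∃ (π : Measure (X × X)) (ζ : C(X, ℝ)), IsCoupling μ ν π ∧ IsKRPotential c ζ ∧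
      ∫ z, c z ∂π = ∫ x, ζ x ∂μ - ∫ x, ζ x ∂ν ∧
      (∀ π' : Measure (X × X), IsCoupling μ ν π' → ∫ z, c z ∂π ≤ ∫ z, c z ∂π') ∧
      (∀ ζ' : C(X, ℝ), IsKRPotential c ζ' →
        ∫ x, ζ' x ∂μ - ∫ x, ζ' x ∂ν ≤ ∫ x, ζ x ∂μ - ∫ x, ζ x ∂ν) ∧
      (∀ᵐ z ∂π, ζ z.1 - ζ z.2 = c z) := by
  obtain ⟨π, hπ, hlub⟩ := exists_isCoupling_isLUB_integral hmass c
  obtain ⟨ζ, hζ, hmax⟩ := exists_isKRPotential_isMax (μ := μ) (ν := ν) hc hmass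
  have heq : ∫ z, c z ∂π = ∫ x, ζ x ∂μ - ∫ x, ζ x ∂ν := by
    apply le_antisymm
    · refine hlub.2 ?_
      rintro r ⟨φ, ψ, hle, rfl⟩
      obtain ⟨ζ'', hζ'', hge⟩ := exists_isKRPotential_ge (μ := μ) (ν := ν) hc hle
      exact hge.trans (hmax ζ'' hζ'')
    · exact hlub.1 (krValues_subset_dualValues c ⟨ζ, hζ, rfl⟩)
  haveI := hπ.isFiniteMeasure
  refine ⟨π, ζ, hπ, hζ, heq, fun π' hπ' => ?_, hmax, ?_⟩
  · exact hlub.2 fun r ⟨φ, ψ, hle, hr⟩ => hr ▸ integral_add_integral_le_of_isCoupling hπ' hle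
  · -- complementary slackness
    let G : C(X × X, ℝ) := c - (ζ.comp ContinuousMap.fst - ζ.comp ContinuousMap.snd)
    have hG0 : ∀ z, 0 ≤ G z := fun z => by
      simp only [G, ContinuousMap.sub_apply, ContinuousMap.comp_apply, ContinuousMap.fst_apply,
        ContinuousMap.snd_apply, sub_nonneg]
      exact hζ z.1 z.2
    have hGi : ∫ z, G z ∂π = 0 := by
      simp only [G, ContinuousMap.sub_apply, ContinuousMap.comp_apply, ContinuousMap.fst_apply,
        ContinuousMap.snd_apply]
      rw [integral_sub (integrable_continuousMap π c), integral_sub, heq,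
        hπ.integral_comp_fst (integrable_continuousMap μ ζ).aestronglyMeasurable,
        hπ.integral_comp_snd (integrable_continuousMap ν ζ).aestronglyMeasurable]
      · ring
      · exact integrable_continuousMap π (ζ.comp ContinuousMap.fst)
      · exact integrable_continuousMap π (ζ.comp ContinuousMap.snd)
      · exact (integrable_continuousMap π (ζ.comp ContinuousMap.fst)).sub
          (integrable_continuousMap π (ζ.comp ContinuousMap.snd))
    have hae := (integral_eq_zero_iff_of_nonneg (fun z => hG0 z) (integrable_continuousMap π G)).mp hGi
    filter_upwards [hae] with z hz
    simp only [G, ContinuousMap.sub_apply, ContinuousMap.comp_apply, ContinuousMap.fst_apply,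
      ContinuousMap.snd_apply, Pi.zero_apply] at hz
    linarith

end KantorovichRubinstein

end Literature.MeasureTheory.OptimalTransport
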